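import Literature.AlgebraicGeometry.Motives.GeneratingSectionsToProjRatios
import HarnessLib

/-!
# Re-embedding a projective scheme by forms of one degree

Let `k` be a commutative ring, `r : Y → ℙ(ι)_k = Proj k[xᵢ : i ∈ ι]` a morphism over `k`
(`f : Y → Spec k`, `r ≫ toSpec = f`), `d ≥ 1`, and `V_l ∈ k[x]_d`, `l ∈ L`, a family of forms of
degree `d`. The sections `x_i^{2d}`, `x_{i'} x_i^{2d-1}`, `x_i^d · V_l` of `r^*𝒪(2d)` (indexed by
`ι × (Option ι ⊕ L)`: `(i, inl none)`, `(i, inl (some i'))`, `(i, inr l)`) have no common zero, so they define a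
`k`-morphism `GeneratingSections.formsMap : Y → ℙ(M)_k` for any labelling `e : M ≃ ι × (Option ι ⊕ L)`
of the homogeneous coordinates (Hartshorne II Thm. 7.1 (b), in the chart form
`GeneratingSections.toProj` of `Motives/MorphismsToProjectiveSpace`, applied to the data
`GeneratingSections.formsData` = `GeneratingSections.ofSections` of these sections, each supported in
its "home chart" `r⁻¹D₊(xᵢ)` — the construction of `Motives/ProjectiveOfGeneratingSections` with
EXPLICIT sections in place of chosen extensions of generators). This file proves:

* `GeneratingSections.formsMap_preimage_basicOpen_of_eq_none`, `…homRatio_formsMap_of_eq_inr` —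
  the chart of `formsMap` at a coordinate `a ↔ (i, none)` is `r⁻¹D₊(xᵢ)`, and there the coordinate
  ratio `y_b/y_a`, `b ↔ (i'', inr l)`, pulls back to `r^*(V_l/x_i^d) · r^*(x_{i''}/x_i)^d` — so on
  that chart the coordinates `y_{(·, inr l)}` restricted to `Y` generate the same ideal as the
  `r^*(V_l/x_i^d)`;
* `GeneratingSections.isClosedImmersion_formsMap` — **if `r` is a closed immersion (and `ι` is
  finite), `formsMap` is a closed immersion**: over the charts `D₊(y_a)`, `a ↔ (i, none)`, which
  cover the image, it is a closed immersion by Hartshorne II Prop. 7.2 (the chart `r⁻¹D₊(xᵢ)` is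
  affine and its ring is generated by the `r^*(x_{i'}/xᵢ) = y_{(i, inl i')}/y_{(i,none)}`,
  `GeneratingSections.closure_ofHom_eq_top`), and the image is closed because `Y → Spec k` is
  universally closed (`ℙ(ι)_k → Spec k` is proper) and `ℙ(M)_k → Spec k` separated
  (`GeneratingSections.isClosedImmersion_of_restrict`).

This is the elementary form of "`𝓛` very ample ⇒ `𝓛^{⊗2d}` very ample, with any further sections
adjoined" (Hartshorne II Ex. 5.13, 5.14 and the proof of Thm. 7.6; Görtz–Wedhorn I, (13.12) and
Prop. 13.56), used to realise a finite family of forms as coordinate hyperplane sections of a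
projective embedding. NOT here: line bundles, `𝒪(d)` as a sheaf, the Veronese map as `Proj` of a
graded ring homomorphism.

## References

* R. Hartshorne, *Algebraic Geometry*, GTM 52 (1977): II Thm. 7.1, II Prop. 7.2, proof of
  II Thm. 7.6, II Ex. 5.13, 5.14. [Hartshorne1977]
* U. Görtz, T. Wedhorn, *Algebraic Geometry I: Schemes*, 2nd ed. (2020): (13.12), Prop. 13.56,
  Summary 13.71. [GortzWedhorn2020]
-/

universe u

open CategoryTheory AlgebraicGeometry Limits HomogeneousLocalization TopologicalSpace Opposite
open MvPolynomial (X C eval₂Hom eval₂)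
open Literature.AlgebraicGeometry.Motives.Segre

attribute [local instance] MvPolynomial.gradedAlgebra

noncomputable section

namespace Literature.AlgebraicGeometry.Motives

namespace GeneratingSections

/-! ### The sections `x_i^{2d}`, `x_{i'} x_i^{2d-1}`, `x_i^d V_l` of `r^*𝒪(2d)` -/

section Forms

variable {ι : Type} {k : Type u} [CommRing k] {Y : Scheme.{u}} (f : Y ⟶ Spec (.of k))
  (r : Y ⟶ Proj (grading ι k)) {d : ℕ} (hd : 0 < d) {L : Type}
  (V : L → MvPolynomial ι k) (hV : ∀ l, (V l).IsHomogeneous d)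

/-- The degree-`d` factors of the new sections: `x_i^d` at `(i, inl none)`, `x_{i'} x_i^{d-1}` at
`(i, inl (some i'))`, `V_l` at `(i, inr l)` — as sections of `r^*𝒪(d)` in chart form
(`GeneratingSections.Sec`). [cite: Hartshorne1977, II Thm. 7.1 (b)] -/
def formsτ : ι × (Option ι ⊕ L) → (ofHom r).Sec d
  | (i, Sum.inl none) => Sec.pow (ofHom r) i d
  | (i, Sum.inl (some i')) =>
      ((Sec.pow (ofHom r) i' 1).mul (Sec.pow (ofHom r) i (d - 1))).cast (Nat.add_sub_cancel' hd)
  | (_, Sum.inr l) => (ofHom r).secOfForm f (V l) (hV l)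

/-- **The sections defining the re-embedding**: `σ_m = τ_m ⊗ x_i^d ∈ Γ(Y, r^*𝒪(2d))` for
`m = (i, _)` (home chart `i`), i.e. `x_i^{2d}`, `x_{i'} x_i^{2d-1}`, `x_i^d V_l`. [cite: Hartshorne1977, II Thm. 7.1 (b)] -/
def formsSec (m : ι × (Option ι ⊕ L)) : (ofHom r).Sec (d + d) :=
  (formsτ f r hd V hV m).mul (Sec.pow (ofHom r) m.1 d)

/-- On the home chart of `m` the value of `σ_m` is that of `τ_m`. [cite: Hartshorne1977, II Thm. 7.1 (b)] -/
theorem formsSec_val_home (m : ι × (Option ι ⊕ L)) :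
    (formsSec f r hd V hV m).val m.1 = (formsτ f r hd V hV m).val m.1 := by
  simp only [formsSec, Sec.mul_val, Sec.pow_val, (ofHom r).ratio_self, one_pow, mul_one]

/-- On the home chart `i` the value of `σ_{(i, o)}` is that of `τ_{(i, o)}`.
[cite: Hartshorne1977, II Thm. 7.1 (b)] -/
theorem formsSec_val_home_mk (i : ι) (o : Option ι ⊕ L) :
    (formsSec f r hd V hV (i, o)).val i = (formsτ f r hd V hV (i, o)).val i :=
  formsSec_val_home f r hd V hV (i, o)

/-- The value of `σ_{(i'', o)}` on the chart `i`: `τ(s_•/s_i) · (s_{i''}/s_i)^d`. [cite: Hartshorne1977, II Thm. 7.1 (b)] -/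
theorem formsSec_val (m : ι × (Option ι ⊕ L)) (i : ι) :
    (formsSec f r hd V hV m).val i =
      (formsτ f r hd V hV m).val i * (ofHom r).ratio i m.1 ^ d := rfl

/-- `τ_{(i, none)} = x_i^d` has value `1` on the chart `i`. [cite: Hartshorne1977, II Thm. 7.1 (b)] -/
@[simp] theorem formsτ_val_none_self (i : ι) : (formsτ f r hd V hV (i, Sum.inl none)).val i = 1 := by
  simp only [formsτ, Sec.pow_val, (ofHom r).ratio_self, one_pow]

/-- `τ_{(i'', inl i')} = x_{i'} x_{i''}^{d-1}` has value `(s_{i'}/s_i)(s_{i''}/s_i)^{d-1}` on the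
chart `i`. [cite: Hartshorne1977, II Thm. 7.1 (b)] -/
@[simp] theorem formsτ_val_inl (i'' i' i : ι) :
    (formsτ f r hd V hV (i'', Sum.inl (some i'))).val i =
      (ofHom r).ratio i i' * (ofHom r).ratio i i'' ^ (d - 1) := by
  simp only [formsτ, Sec.cast_val, Sec.mul_val, Sec.pow_val, pow_one]

/-- `τ_{(i'', inr l)} = V_l` has value `V_l(…, s_j/s_i, …) = r^*(V_l/x_i^d)` on the chart `i`.
[cite: Hartshorne1977, II Thm. 7.1 (b)] -/
@[simp] theorem formsτ_val_inr (i'' : ι) (l : L) (i : ι) :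
    (formsτ f r hd V hV (i'', Sum.inr l)).val i = (ofHom r).sectionsFun f i (V l) := rfl

/-- Each `σ_m` is supported in its home chart `i`: `Y_{σ_m} ⊆ r⁻¹D₊(xᵢ)` (the factor `x_i^d`,
`d ≥ 1`). [cite: Hartshorne1977, II Thm. 7.1 (b)] -/
theorem formsSec_home (m : ι × (Option ι ⊕ L)) (j : ι) :
    Y.basicOpen ((formsSec f r hd V hV m).val j) ≤ (ofHom r).U m.1 := by
  rw [formsSec, Sec.mul_val, Sec.pow_val, Y.basicOpen_mul, Y.basicOpen_pow _ hd]
  exact inf_le_right.trans ((ofHom r).V_le_right j m.1)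

/-- The non-vanishing locus of `σ_{(i, none)} = x_i^{2d}` is the whole chart `r⁻¹D₊(xᵢ)`.
[cite: Hartshorne1977, II Thm. 7.1 (b)] -/
theorem basicOpen_formsSec_none (i : ι) :
    Y.basicOpen ((formsSec f r hd V hV (i, Sum.inl none)).val i) = (ofHom r).U i := by
  rw [formsSec_val_home_mk, formsτ_val_none_self, Y.basicOpen_one]

/-- The `σ_m` have no common zero (already the `x_i^{2d}` do not). [cite: Hartshorne1977, II Thm. 7.1 (b)] -/
theorem iSup_basicOpen_formsSec :
    ⨆ m : ι × (Option ι ⊕ L), Y.basicOpen ((formsSec f r hd V hV m).val m.1) = ⊤ := by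
  rw [← top_le_iff, ← (ofHom r).iSup_U, iSup_le_iff]
  intro i
  rw [← basicOpen_formsSec_none f r hd V hV i]
  exact le_iSup (fun m : ι × (Option ι ⊕ L) ↦
    Y.basicOpen ((formsSec f r hd V hV m).val m.1)) (i, Sum.inl none)

/-- **The generating-sections data of the re-embedding** (`GeneratingSections.ofSections` of the
`σ_m`, home charts `Prod.fst`): opens `Y_{σ_m}`, ratios `σ_{m'}/σ_m`. [cite: Hartshorne1977, II Thm. 7.1 (b)] -/
def formsData : GeneratingSections (ι × (Option ι ⊕ L)) Y :=
  (ofHom r).ofSections Prod.fst (formsSec f r hd V hV) (formsSec_home f r hd V hV)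
    (iSup_basicOpen_formsSec f r hd V hV)

/-- The opens of `formsData` are the `Y_{σ_m}` (basic opens of the home charts). [cite: Hartshorne1977, II Thm. 7.1 (b)] -/
theorem formsData_U (m : ι × (Option ι ⊕ L)) :
    (formsData f r hd V hV).U m = Y.basicOpen ((formsSec f r hd V hV m).val m.1) := rfl

/-- The opens of `formsData`, for an index in pair form. [cite: Hartshorne1977, II Thm. 7.1 (b)] -/
theorem formsData_U_mk (i : ι) (o : Option ι ⊕ L) :
    (formsData f r hd V hV).U (i, o) = Y.basicOpen ((formsSec f r hd V hV (i, o)).val i) := rfl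

/-- The chart of `(i, none)` is the chart `U i` of `ofHom r`. [cite: Hartshorne1977, II Thm. 7.1 (b)] -/
theorem formsData_U_none' (i : ι) : (formsData f r hd V hV).U (i, Sum.inl none) = (ofHom r).U i :=
  basicOpen_formsSec_none f r hd V hV i

/-- **The chart of `(i, none)` is `r⁻¹D₊(xᵢ)`.** [cite: Hartshorne1977, II Thm. 7.1 (b)] -/
theorem formsData_U_none (i : ι) :
    (formsData f r hd V hV).U (i, Sum.inl none) = r ⁻¹ᵁ Proj.basicOpen (grading ι k) (X i) :=
  basicOpen_formsSec_none f r hd V hV i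

include hV in
/-- The forms `V_l` lie in the degree-`d • 1` piece of the grading (the form in which
`HomogeneousLocalization.Away.mk` consumes homogeneity). [folklore] -/
private theorem mem_grading_of_isHomogeneous (l : L) : V l ∈ grading ι k (d • 1) := by
  simpa using hV l

/-- The chart of `(i, inr l)` is `r⁻¹D₊(xᵢ) ∩ r⁻¹D₊(V_l)` (for `r` over `k`). [cite: Hartshorne1977, II Thm. 7.1 (b)] -/
theorem formsData_U_inr (hr : r ≫ toSpec ι k = f) (i : ι) (l : L) :
    (formsData f r hd V hV).U (i, Sum.inr l) =
      r ⁻¹ᵁ Proj.basicOpen (grading ι k) (X i) ⊓ r ⁻¹ᵁ Proj.basicOpen (grading ι k) (V l) := by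
  rw [formsData_U_mk, formsSec_val_home_mk, formsτ_val_inr,
    basicOpen_sectionsFun_ofHom f r hr i hd (V l) (mem_grading_of_isHomogeneous V hV l)]

/-- All the charts of `formsData` are affine when `r` is an affine morphism (basic opens of the
affine `r⁻¹D₊(xᵢ)`). [cite: Hartshorne1977, II Thm. 7.1 (b)] -/
theorem isAffineOpen_formsData_U [IsAffineHom r] (m : ι × (Option ι ⊕ L)) :
    IsAffineOpen ((formsData f r hd V hV).U m) :=
  (isAffineOpen_ofHom_U r m.1).basicOpen _

/-- **The ratios at a home chart**: `σ_{m'}/σ_{(i, none)} = σ_{m'}/x_i^{2d}` is the chart-`i` value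
of `σ_{m'}` (restricted along `Y_{x_i^{2d}} = r⁻¹D₊(xᵢ)`). [cite: Hartshorne1977, II Thm. 7.1 (b)] -/
theorem formsData_ratio_none (i : ι) (m' : ι × (Option ι ⊕ L)) :
    (formsData f r hd V hV).ratio (i, Sum.inl none) m' =
      rs (formsData_U_none' f r hd V hV i).le ((formsSec f r hd V hV m').val i) := by
  have h := (ofHom r).ratio'_mul_num Prod.fst (formsSec f r hd V hV) (i, Sum.inl none) m'
  rw [num, formsSec_val_home, formsτ_val_none_self, map_one, mul_one] at h
  exact h

/-- `y_{(i'', inr l)}/y_{(i, none)}` pulls back to `r^*(V_l/x_i^d) · r^*(x_{i''}/x_i)^d`.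
[cite: Hartshorne1977, II Thm. 7.1 (b)] -/
theorem formsData_ratio_none_inr (i i'' : ι) (l : L) :
    (formsData f r hd V hV).ratio (i, Sum.inl none) (i'', Sum.inr l) =
      rs (formsData_U_none' f r hd V hV i).le
        ((ofHom r).sectionsFun f i (V l) * (ofHom r).ratio i i'' ^ d) := by
  rw [formsData_ratio_none, formsSec_val, formsτ_val_inr]

/-- In particular `y_{(i, inr l)}/y_{(i, none)}` pulls back to `r^*(V_l/x_i^d)`. [cite: Hartshorne1977, II Thm. 7.1 (b)] -/
theorem formsData_ratio_none_inr_self (i : ι) (l : L) :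
    (formsData f r hd V hV).ratio (i, Sum.inl none) (i, Sum.inr l) =
      rs (formsData_U_none' f r hd V hV i).le ((ofHom r).sectionsFun f i (V l)) := by
  rw [formsData_ratio_none_inr, (ofHom r).ratio_self, one_pow, mul_one]

/-- `y_{(i'', inl i')}/y_{(i, none)}` pulls back to `r^*(x_{i'}/x_i) · r^*(x_{i''}/x_i)^{2d-1}`.
[cite: Hartshorne1977, II Thm. 7.1 (b)] -/
theorem formsData_ratio_none_inl (i i'' i' : ι) :
    (formsData f r hd V hV).ratio (i, Sum.inl none) (i'', Sum.inl (some i')) =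
      rs (formsData_U_none' f r hd V hV i).le
        ((ofHom r).ratio i i' * (ofHom r).ratio i i'' ^ (d - 1) * (ofHom r).ratio i i'' ^ d) := by
  rw [formsData_ratio_none, formsSec_val, formsτ_val_inl]

/-- In particular `y_{(i, inl i')}/y_{(i, none)}` pulls back to `r^*(x_{i'}/x_i)`. [cite: Hartshorne1977, II Thm. 7.1 (b)] -/
theorem formsData_ratio_none_inl_self (i i' : ι) :
    (formsData f r hd V hV).ratio (i, Sum.inl none) (i, Sum.inl (some i')) =
      rs (formsData_U_none' f r hd V hV i).le ((ofHom r).ratio i i') := by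
  rw [formsData_ratio_none_inl, (ofHom r).ratio_self, one_pow, one_pow, mul_one, mul_one]

/-- The constants of the chart `(i, none)` are those of `r⁻¹D₊(xᵢ)`. [cite: Hartshorne1977, II Thm. 7.1 (b)] -/
theorem formsData_cstr_none (i : ι) (c : k) :
    (formsData f r hd V hV).cstr f (i, Sum.inl none) c =
      rs (formsData_U_none' f r hd V hV i).le ((ofHom r).cstr f i c) := by
  change rs _ (pull f c) = rs _ (rs _ (pull f c))
  rw [rs_rs]

/-- **Surjectivity at the home charts** (hypothesis (2) of Hartshorne II Prop. 7.2 for the charts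
`D₊(y_{(i, none)})`): for a closed immersion `r`, `Γ(Y, Y_{x_i^{2d}}) = Γ(Y, r⁻¹D₊(xᵢ))` is
generated by the constants and the ratios `y_{m'}/y_{(i,none)}` — already by the
`y_{(i, inl i')}/y_{(i, none)} = r^*(x_{i'}/xᵢ)`. [cite: Hartshorne1977, II Prop. 7.2] -/
theorem closure_formsData_none (hr : r ≫ toSpec ι k = f) [IsClosedImmersion r] (i : ι) :
    Subring.closure (Set.range ((formsData f r hd V hV).cstr f (i, Sum.inl none)) ∪
      Set.range ((formsData f r hd V hV).ratio (i, Sum.inl none))) = ⊤ := by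
  set θ : Γ(Y, (ofHom r).U i) →+* Γ(Y, (formsData f r hd V hV).U (i, Sum.inl none)) :=
    rs (formsData_U_none' f r hd V hV i).le with hθ
  have hθsurj : Function.Surjective θ := by
    intro s
    refine ⟨rs (formsData_U_none' f r hd V hV i).symm.le s, ?_⟩
    rw [hθ, rs_rs, rs_refl]
  have hsub : θ '' (Set.range ((ofHom r).cstr f i) ∪ Set.range ((ofHom r).ratio i)) ⊆
      Set.range ((formsData f r hd V hV).cstr f (i, Sum.inl none)) ∪
        Set.range ((formsData f r hd V hV).ratio (i, Sum.inl none)) := by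
    rintro _ ⟨s, hs | hs, rfl⟩
    · obtain ⟨c, rfl⟩ := hs
      exact Or.inl ⟨c, formsData_cstr_none f r hd V hV i c⟩
    · obtain ⟨i', rfl⟩ := hs
      exact Or.inr ⟨(i, Sum.inl (some i')), formsData_ratio_none_inl_self f r hd V hV i i'⟩
  rw [← top_le_iff]
  calc (⊤ : Subring _) = θ.range := (RingHom.range_eq_top.mpr hθsurj).symm
    _ = (Subring.closure (Set.range ((ofHom r).cstr f i) ∪ Set.range ((ofHom r).ratio i))).map θ := by
        rw [closure_ofHom_eq_top f r hr i, ← RingHom.range_eq_map]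
    _ = Subring.closure (θ '' (Set.range ((ofHom r).cstr f i) ∪ Set.range ((ofHom r).ratio i))) :=
        RingHom.map_closure _ _
    _ ≤ _ := Subring.closure_mono hsub

/-! ### The morphism `Y → ℙ(M)_k` (any index type `M ≃ ι × (Option ι ⊕ L)`) -/

variable {M : Type} (e : M ≃ ι × (Option ι ⊕ L))

omit hd hV in
/-- Reindexing generating-sections data does not change the generation property of a chart:
the constants and ratios at the chart `a` of `D.reindex e` are those of `D` at `e a`. [folklore] -/
private theorem closure_reindex_eq_top {ι' : Type} (D : GeneratingSections ι' Y) {M' : Type} (e' : M' ≃ ι')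
    (a : M') (h : Subring.closure (Set.range (D.cstr f (e' a)) ∪ Set.range (D.ratio (e' a))) = ⊤) :
    Subring.closure (Set.range ((D.reindex e').cstr f a) ∪ Set.range ((D.reindex e').ratio a)) = ⊤ := by
  have hr : Set.range ((D.reindex e').ratio a) = Set.range (D.ratio (e' a)) := by
    change Set.range (fun b ↦ D.ratio (e' a) (e' b)) = _
    exact e'.surjective.range_comp (D.ratio (e' a))
  rw [hr]
  exact h

/-- **The re-embedding `Y → ℙ(M)_k` defined by the forms** `x_i^{2d}, x_{i'} x_i^{2d-1}, x_i^d V_l`,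
the homogeneous coordinates of `ℙ(M)_k` being labelled by `e : M ≃ ι × (Option ι ⊕ L)`
(Hartshorne II Thm. 7.1 (b) for these generating sections of `r^*𝒪(2d)`; take `e = Equiv.refl _`
for the canonical labelling, or `M = Fin (N + 1)`). [cite: Hartshorne1977, II Thm. 7.1 (b)] -/
def formsMap : Y ⟶ Proj (grading M k) :=
  ((formsData f r hd V hV).reindex e).toProj f

/-- `formsMap` is a morphism over `k`. [cite: Hartshorne1977, II Thm. 7.1 (b)] -/
theorem formsMap_toSpec : formsMap f r hd V hV e ≫ toSpec M k = f :=
  ((formsData f r hd V hV).reindex e).toProj_toSpec f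

/-- `formsMap⁻¹D₊(y_a) = Y_{σ_{e a}}`. [cite: Hartshorne1977, II Thm. 7.1 (b)] -/
theorem formsMap_preimage_basicOpen (a : M) :
    formsMap f r hd V hV e ⁻¹ᵁ Proj.basicOpen (grading M k) (X a) = (formsData f r hd V hV).U (e a) :=
  ((formsData f r hd V hV).reindex e).toProj_preimage_basicOpen f a

/-- **`formsMap⁻¹D₊(y_a) = r⁻¹D₊(xᵢ)` for the coordinate `a ↔ (i, none)`.** [cite: Hartshorne1977, II Thm. 7.1 (b)] -/
theorem formsMap_preimage_basicOpen_of_eq_none {a : M} {i : ι} (ha : e a = (i, Sum.inl none)) :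
    formsMap f r hd V hV e ⁻¹ᵁ Proj.basicOpen (grading M k) (X a) =
      r ⁻¹ᵁ Proj.basicOpen (grading ι k) (X i) := by
  rw [formsMap_preimage_basicOpen, ha, formsData_U_none]

/-- The charts `formsMap⁻¹D₊(y_{(i, none)})` cover `Y`. [cite: Hartshorne1977, II Thm. 7.1 (b)] -/
theorem iSup_preimage_basicOpen_none :
    ⨆ i : ι, formsMap f r hd V hV e ⁻¹ᵁ Proj.basicOpen (grading M k) (X (e.symm (i, Sum.inl none))) = ⊤ := by
  have h : ∀ i : ι, formsMap f r hd V hV e ⁻¹ᵁ Proj.basicOpen (grading M k) (X (e.symm (i, Sum.inl none))) =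
      (ofHom r).U i := fun i ↦
    (formsMap_preimage_basicOpen_of_eq_none f r hd V hV e (e.apply_symm_apply (i, Sum.inl none))).trans rfl
  simp_rw [h]
  exact (ofHom r).iSup_U

/-- All the preimages `formsMap⁻¹D₊(y_a)` are affine when `r` is affine. [cite: Hartshorne1977, II Thm. 7.1 (b)] -/
theorem isAffineOpen_formsMap_preimage_basicOpen [IsAffineHom r] (a : M) :
    IsAffineOpen (formsMap f r hd V hV e ⁻¹ᵁ Proj.basicOpen (grading M k) (X a)) := by
  rw [formsMap_preimage_basicOpen]
  exact isAffineOpen_formsData_U f r hd V hV (e a)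

/-- The ratios of `ofHom formsMap` are those of `formsData` (restricted along
`formsMap⁻¹D₊(y_a) = Y_{σ_{e a}}`). [cite: Hartshorne1977, II Thm. 7.1 (b)] -/
theorem homRatio_formsMap (a b : M) :
    homRatio (formsMap f r hd V hV e) a b =
      rs (formsMap_preimage_basicOpen f r hd V hV e a).le ((formsData f r hd V hV).ratio (e a) (e b)) :=
  ((formsData f r hd V hV).reindex e).homRatio_toProj f a b

/-- **`formsMap^*(y_b/y_a) = r^*(V_l/x_i^d) · r^*(x_{i''}/xᵢ)^d`** on `formsMap⁻¹D₊(y_a) = r⁻¹D₊(xᵢ)`,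
for the coordinates `a ↔ (i, none)`, `b ↔ (i'', inr l)`: the coordinates `y_{(·, inr l)}` cut out,
on the image of the chart `r⁻¹D₊(xᵢ)`, the ideal generated by the `r^*(V_l/x_i^d)`. The right-hand
restriction is along any proof `hW` of `formsMap⁻¹D₊(y_a) ≤ r⁻¹D₊(xᵢ)`
(e.g. `(formsMap_preimage_basicOpen_of_eq_none … ha).le`). [cite: Hartshorne1977, II Thm. 7.1 (b)] -/
theorem homRatio_formsMap_of_eq_inr {a b : M} {i i'' : ι} {l : L} (ha : e a = (i, Sum.inl none))
    (hb : e b = (i'', Sum.inr l))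
    (hW : formsMap f r hd V hV e ⁻¹ᵁ Proj.basicOpen (grading M k) (X a) ≤ (ofHom r).U i) :
    homRatio (formsMap f r hd V hV e) a b =
      rs hW ((ofHom r).sectionsFun f i (V l) * (ofHom r).ratio i i'' ^ d) := by
  have key : ∀ (m m' : ι × (Option ι ⊕ L)), m = (i, Sum.inl none) → m' = (i'', Sum.inr l) →
      ∀ {W : Y.Opens} (h : W ≤ (formsData f r hd V hV).U m) (h' : W ≤ (ofHom r).U i),
        rs h ((formsData f r hd V hV).ratio m m') =
          rs h' ((ofHom r).sectionsFun f i (V l) * (ofHom r).ratio i i'' ^ d) := by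
    rintro _ _ rfl rfl W h h'
    rw [formsData_ratio_none_inr, rs_rs]
  rw [homRatio_formsMap]
  exact key _ _ ha hb _ hW

/-- In particular **`formsMap^*(y_b/y_a) = r^*(V_l/x_i^d)`** for `a ↔ (i, none)`, `b ↔ (i, inr l)`.
[cite: Hartshorne1977, II Thm. 7.1 (b)] -/
theorem homRatio_formsMap_of_eq_inr_self {a b : M} {i : ι} {l : L} (ha : e a = (i, Sum.inl none))
    (hb : e b = (i, Sum.inr l))
    (hW : formsMap f r hd V hV e ⁻¹ᵁ Proj.basicOpen (grading M k) (X a) ≤ (ofHom r).U i) :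
    homRatio (formsMap f r hd V hV e) a b = rs hW ((ofHom r).sectionsFun f i (V l)) := by
  rw [homRatio_formsMap_of_eq_inr f r hd V hV e ha hb hW, (ofHom r).ratio_self, one_pow, mul_one]

/-- The chart values of `ofHom r` in Mathlib's vocabulary: `(ofHom r).sectionsFun f i F = r^*(F/x_i^e)`,
the section `Proj.awayToSection (F/x_i^e)` over `D₊(xᵢ)` (`HomogeneousLocalization.Away.isLocalizationElem`)
pulled back by `r.app`. [cite: Hartshorne1977, II Thm. 7.1 (a)] -/
theorem sectionsFun_ofHom_eq_app (hr : r ≫ toSpec ι k = f) (i : ι) {e' : ℕ} (F : MvPolynomial ι k)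
    (hF : F ∈ grading ι k e') :
    (ofHom r).sectionsFun f i F = r.app (Proj.basicOpen (grading ι k) (X i))
      (Proj.awayToSection (grading ι k) (X i) (Away.isLocalizationElem (X_mem k i) hF)) := by
  have hF' : F ∈ grading ι k (e' • 1) := by simpa using hF
  have h2 : Away.mk _ (X_mem k i) e' F hF' = Away.isLocalizationElem (X_mem k i) hF := by
    simp only [Away.isLocalizationElem, pow_one]
  rw [sectionsFun_ofHom_eq f r hr i F hF', Scheme.Hom.app_eq_appLE, h2]
  exact topIso_hom_pull_chartLift r i _

/-- **`formsMap^*(y_b/y_a) = r^*(V_l/x_i^d)`** for `a ↔ (i, none)`, `b ↔ (i, inr l)`, with the right-hand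
side in Mathlib's vocabulary (`r.app`, `Proj.awayToSection`, `Away.isLocalizationElem`).
[cite: Hartshorne1977, II Thm. 7.1 (b)] -/
theorem homRatio_formsMap_of_eq_inr_self_eq_app (hr : r ≫ toSpec ι k = f) {a b : M} {i : ι} {l : L}
    (ha : e a = (i, Sum.inl none)) (hb : e b = (i, Sum.inr l))
    (hW : formsMap f r hd V hV e ⁻¹ᵁ Proj.basicOpen (grading M k) (X a) ≤ (ofHom r).U i) :
    homRatio (formsMap f r hd V hV e) a b = rs hW (r.app (Proj.basicOpen (grading ι k) (X i))
      (Proj.awayToSection (grading ι k) (X i)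
        (Away.isLocalizationElem (X_mem k i) (by simpa using hV l : V l ∈ grading ι k d)))) := by
  rw [homRatio_formsMap_of_eq_inr_self f r hd V hV e ha hb hW, sectionsFun_ofHom_eq_app f r hr]

/-- **The re-embedding by forms of one degree is a closed immersion** when `r` is a closed
immersion and `ι` is finite: over the charts `D₊(y_a)`, `a ↔ (i, none)`, whose preimages
`r⁻¹D₊(xᵢ)` cover `Y`, it is a closed immersion by Hartshorne II Prop. 7.2 (`r⁻¹D₊(xᵢ)` affine,
chart ring map surjective), and its image is closed, `Y → Spec k` being universally closed
(`ℙ(ι)_k → Spec k` is proper) and `ℙ(M)_k → Spec k` separated. [cite: Hartshorne1977, II Prop. 7.2] -/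
theorem isClosedImmersion_formsMap [Finite ι] (hr : r ≫ toSpec ι k = f) [IsClosedImmersion r] :
    IsClosedImmersion (formsMap f r hd V hV e) := by
  refine isClosedImmersion_of_restrict (formsMap f r hd V hV e) (κ := ι)
    (fun i ↦ Proj.basicOpen (grading M k) (X (e.symm (i, Sum.inl none))))
    (iSup_preimage_basicOpen_none f r hd V hV e) (fun i ↦ ?_) ?_
  · refine ((formsData f r hd V hV).reindex e).isClosedImmersion_toProj_restrict f (e.symm (i, Sum.inl none))
      ?_ (((formsData f r hd V hV).reindex e).sectionsRingHom_surjective_of_closure_eq_top f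
        (e.symm (i, Sum.inl none)) (closure_reindex_eq_top f _ e _ ?_))
    · rw [reindex_U, e.apply_symm_apply]
      exact isAffineOpen_formsData_U f r hd V hV (i, Sum.inl none)
    · rw [e.apply_symm_apply]
      exact closure_formsData_none f r hd V hV hr i
  · -- the image is closed: `formsMap` is universally closed
    have h1 : UniversallyClosed (r ≫ toSpec ι k) := by
      haveI : IsProper (toSpec ι k) := ProjBaseChangeRing.isProper_projToSpec ι k
      infer_instance
    have h2 : UniversallyClosed (formsMap f r hd V hV e ≫ toSpec M k) := by
      rw [formsMap_toSpec, ← hr]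
      exact h1
    have h3 : IsSeparated (toSpec M k) := by
      unfold toSpec
      infer_instance
    have h4 : UniversallyClosed (formsMap f r hd V hV e) :=
      .of_comp_of_isSeparated _ (toSpec M k)
    exact (formsMap f r hd V hV e).isClosedMap.isClosed_range

end Forms

end GeneratingSections

end Literature.AlgebraicGeometry.Motives

end
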